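import Mathlib
import Literature.NumberTheory.LFunctions.RayClassGaussSum
import Summits.Langlands.Langlands.Theorems.QuadraticWindowTwistNormalizationIndexTwo
import Summits.Langlands.Langlands.Theorems.QuadraticWindowTwistNormalizationKummer

/-!
# Support for `TwistNormalization` (route `QuadraticWindow`, stmt-Langlands-10904), III:
# the sign-correcting quadratic character

Let `F/F₀` be quadratic with non-trivial automorphism `τ`, `t ∈ Γ_{F₀}` a lift of `τ`, and
`θ : Γ_{F₀} → ℂˣ` a character (the polarization character `e` of the route, read through `det`).
The real embeddings `φ` of `F` come in pairs `{φ, φ ∘ τ}` (the places of `F` above a real place of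
`F₀` split in `F`), and `θ(res c_φ) = θ(res c_{φτ}) = ±1` for complex conjugations `c_φ`, `c_{φτ}`.
We produce a quadratic character `θ_S : Γ_F → ℂˣ` with open kernel, unramified above a given
rational prime `ℓ`, such that

  `θ(res c) · θ_S(c) · θ_S(θ_t c) = -1`

for every complex conjugation `c` of `Γ_F` (`θ_t = absGaloisOuterConj F₀ F t`, which carries a
complex conjugation at `φ` to one at `φ ∘ τ̄⁻¹`): `θ_S` is the Kummer character of an integer
`a ≡ 1 (mod 4ℓ)` whose signs at the real embeddings solve the displayed sign equations
(`exists_signCharacter`).  This is the Galois side of "twist `π` by a quadratic Hecke character of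
suitable signature to normalise the parity of the polarization character" (Arthur–Clozel 1989,
Ch. 3 §6; Barnet-Lamb–Gee–Geraghty–Taylor, arXiv:1010.2561 §2.1).
-/

set_option linter.dupNamespace false -- project-wide option (lakefile weak.linter.dupNamespace); `Summit.Langlands.Langlands` is the mandated namespace

open Literature.NumberTheory.GaloisRepresentations Literature.NumberTheory.LFunctions
open Field IsDedekindDomain NumberField NumberField.InfinitePlace

namespace Summit.Langlands.Langlands.Theorems.TwistNormalization

/-! ## A sign equation along a fixed-point-free involution -/

/-- **Solving `D(x) s(x) s(ι x) = -1` along a fixed-point-free involution.**  For a fixed-point-free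
involution `ι` of a finite set, and `D = ±1` with `D ∘ ι = D`, there is `s = ±1` with
`D(x) · s(x) · s(ι x) = -1` for all `x` (choose one point in each orbit `{x, ι x}` and put `s = -D`
there, `s = 1` at the other point). [folklore] -/
theorem exists_sign_solution {α : Type*} [Finite α] (ι : α → α) (hιι : ∀ x, ι (ι x) = x)
    (hι : ∀ x, ι x ≠ x) (D : α → ℂ) (hD : ∀ x, D x = 1 ∨ D x = -1) (hDι : ∀ x, D (ι x) = D x) :
    ∃ s : α → ℂ, (∀ x, s x = 1 ∨ s x = -1) ∧ ∀ x, D x * (s x * s (ι x)) = -1 := by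
  classical
  obtain ⟨n, ⟨enc⟩⟩ := Finite.exists_equiv_fin α
  let s : α → ℂ := fun x => if enc x < enc (ι x) then -D x else 1
  have hsdef : ∀ x, s x = if enc x < enc (ι x) then -D x else 1 := fun _ => rfl
  refine ⟨s, fun x => ?_, fun x => ?_⟩
  · by_cases h : enc x < enc (ι x)
    · rw [hsdef, if_pos h]; rcases hD x with h' | h' <;> rw [h'] <;> norm_num
    · exact Or.inl (by rw [hsdef, if_neg h])
  · have hne : enc (ι x) ≠ enc x := fun h => hι x (enc.injective h)
    have hsq : D x * D x = 1 := by rcases hD x with h' | h' <;> rw [h'] <;> norm_num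
    by_cases h : enc x < enc (ι x)
    · rw [hsdef, hsdef, if_pos h, if_neg (by rw [hιι]; exact lt_asymm h)]
      linear_combination (-1 : ℂ) * hsq
    · have h' : enc (ι x) < enc (ι (ι x)) := by rw [hιι]; exact lt_of_le_of_ne (not_lt.mp h) hne
      rw [hsdef, hsdef, if_neg h, if_pos h', hDι]
      linear_combination (-1 : ℂ) * hsq

/-! ## Integers with prescribed signs at the real embeddings -/

section Signs

variable {F : Type} [Field F] [NumberField F]

omit [NumberField F] in
/-- A real embedding composed with `ℝ → ℂ` is a real complex embedding. [folklore] -/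
theorem isReal_ofRealHom_comp (φ : F →+* ℝ) : ComplexEmbedding.IsReal (Complex.ofRealHom.comp φ) := by
  ext x
  simp

omit [NumberField F] in
/-- The real embedding of the real place defined by `φ : F → ℝ` is `φ`. [folklore] -/
theorem embedding_of_isReal_mk_apply (φ : F →+* ℝ) (x : F) :
    embedding_of_isReal (isReal_mk_iff.mpr (isReal_ofRealHom_comp φ)) x = φ x := by
  have h := embedding_of_isReal_apply (isReal_mk_iff.mpr (isReal_ofRealHom_comp φ)) x
  rw [embedding_mk_eq_of_isReal (isReal_ofRealHom_comp φ), RingHom.comp_apply] at h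
  exact Complex.ofReal_injective h

/-- **Integers `≡ 1 mod 𝔪` with prescribed signs at the real embeddings** (weak approximation,
`Literature.NumberTheory.LFunctions.exists_sub_one_mem_sign_eq`, re-indexed by real embeddings).
Neukirch, *Algebraic Number Theory*, VI (1.9). [folklore] -/
theorem exists_sub_one_mem_sign_eq_embedding {𝔪 : Ideal (𝓞 F)} (h𝔪 : 𝔪 ≠ ⊥) (s : (F →+* ℝ) → ℂ)
    (hs : ∀ φ, s φ = 1 ∨ s φ = -1) :
    ∃ a : 𝓞 F, a ≠ 0 ∧ a - 1 ∈ 𝔪 ∧ ∀ φ : F →+* ℝ, (SignType.sign (φ (a : F)) : ℂ) = s φ := by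
  classical
  let ε : {w : InfinitePlace F // IsReal w} → SignType := fun w =>
    if s (embedding_of_isReal w.2) = 1 then 1 else -1
  have hε : ∀ w, ε w ≠ 0 := fun w => by
    simp only [ε]; split_ifs <;> decide
  obtain ⟨a, ha0, ha1, hsign⟩ := exists_sub_one_mem_sign_eq h𝔪 ε hε
  refine ⟨a, ha0, ha1, fun φ => ?_⟩
  let w : {w : InfinitePlace F // IsReal w} :=
    ⟨InfinitePlace.mk (Complex.ofRealHom.comp φ), isReal_mk_iff.mpr (isReal_ofRealHom_comp φ)⟩
  have hw : ∀ x, embedding_of_isReal w.2 x = φ x := embedding_of_isReal_mk_apply φ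
  have e : embedding_of_isReal w.2 = φ := RingHom.ext hw
  have hεw : ε w = if s φ = 1 then 1 else -1 := by simp only [ε, e]
  have h := hsign w
  rw [hw, hεw] at h
  rw [h]
  rcases hs φ with h1 | h1
  · rw [if_pos h1, h1, SignType.coe_one]
  · rw [if_neg (by rw [h1]; norm_num), h1, SignType.coe_neg, SignType.coe_one]

end Signs

/-! ## The sign-correcting character -/

section SignChar

variable {F₀ F : Type} [Field F₀] [NumberField F₀] [Field F] [NumberField F] [Algebra F₀ F]

omit [NumberField F₀] [NumberField F] in
/-- A character of `Γ_{F₀}` takes the same value at (the restrictions of) all complex conjugations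
attached to one real embedding of `F` (they are conjugate). [folklore] -/
theorem apply_absGaloisRestrict_eq_of_isComplexConjugation (θ : absoluteGaloisGroup F₀ →* ℂˣ)
    {φ : F →+* ℝ} {c c' : absoluteGaloisGroup F} (hc : IsComplexConjugation φ c)
    (hc' : IsComplexConjugation φ c') :
    θ (absGaloisRestrict F₀ F c) = θ (absGaloisRestrict F₀ F c') := by
  obtain ⟨x, hx⟩ := hc.isConj hc'
  have h := congrArg (fun g => θ (absGaloisRestrict F₀ F g)) hx.eq
  simp only [map_mul] at h
  rw [mul_comm] at h
  exact mul_right_cancel h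

omit [NumberField F₀] [NumberField F] in
/-- A character of `Γ_{F₀}` is `±1` at (the restriction of) a complex conjugation. [folklore] -/
theorem apply_absGaloisRestrict_sq_of_isComplexConjugation (θ : absoluteGaloisGroup F₀ →* ℂˣ)
    {φ : F →+* ℝ} {c : absoluteGaloisGroup F} (hc : IsComplexConjugation φ c) :
    θ (absGaloisRestrict F₀ F c) * θ (absGaloisRestrict F₀ F c) = 1 := by
  rw [← map_mul, ← map_mul, ← pow_two, hc.sq_eq_one, map_one, map_one]

/-- **The sign-correcting quadratic character.**  Let `[F : F₀] = 2` with non-trivial automorphism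
`τ`, `t ∈ Γ_{F₀}` a lift of `τ`, `θ : Γ_{F₀} → ℂˣ` a character and `ℓ` a rational prime.  There is a
quadratic character `θ_S : Γ_F → ℂˣ` with open kernel, trivial on every inertia group above `ℓ`,
such that `θ(res c) · θ_S(c) · θ_S(θ_t c) = -1` for every complex conjugation `c ∈ Γ_F` at every
real embedding (`θ_t = absGaloisOuterConj F₀ F t`).  It is the Kummer character of an integer
`a ≡ 1 (mod 4ℓ)` with suitable signs (`exists_kummerCharacter`, `exists_sign_solution` applied to
the fixed-point-free involution `φ ↦ φ ∘ τ̄⁻¹` of the real embeddings).  Arthur–Clozel 1989,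
Ch. 3 §6; Barnet-Lamb–Gee–Geraghty–Taylor 2014 (arXiv:1010.2561), §2.1. [folklore] -/
theorem exists_signCharacter (hdeg : Module.finrank F₀ F = 2) {τ : F ≃ₐ[F₀] F} (hτ : τ ≠ 1)
    {t : absoluteGaloisGroup F₀}
    (ht : haveI := isGalois_of_finrank_eq_two hdeg; absGaloisQuot F₀ F t = τ)
    (θ : absoluteGaloisGroup F₀ →* ℂˣ) (ℓ : ℕ) [Fact ℓ.Prime] :
    haveI := isGalois_of_finrank_eq_two hdeg
    ∃ θS : absoluteGaloisGroup F →* ℂˣ, IsOpen (θS.ker : Set (absoluteGaloisGroup F)) ∧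
      (∀ g, θS g * θS g = 1) ∧
      (∀ w : HeightOneSpectrum (𝓞 F), ((ℓ : ℕ) : 𝓞 F) ∈ w.asIdeal →
        ∀ 𝔓 ∈ w.primesAbove, ∀ σ ∈ 𝔓.inertia (absoluteGaloisGroup F), θS σ = 1) ∧
      ∀ (φ : F →+* ℝ) (c : absoluteGaloisGroup F), IsComplexConjugation φ c →
        θ (absGaloisRestrict F₀ F c) * (θS c * θS (absGaloisOuterConj F₀ F t c)) = -1 := by
  haveI := isGalois_of_finrank_eq_two hdeg
  haveI : FiniteDimensional F₀ F := Module.finite_of_finrank_eq_succ hdeg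
  classical
  -- `τ̄ = absGaloisQuot t⁻¹` is `τ⁻¹ = τ`, an automorphism of order two
  set τ' : F ≃ₐ[F₀] F := absGaloisQuot F₀ F t⁻¹ with hτ'
  have hτ'τ : τ' = τ⁻¹ := by rw [hτ', map_inv, ht]
  have hcard : Fintype.card (F ≃ₐ[F₀] F) = 2 := by
    apply le_antisymm (hdeg ▸ AlgEquiv.card_le)
    haveI : Nontrivial (F ≃ₐ[F₀] F) := ⟨⟨τ, 1, hτ⟩⟩
    exact Fintype.one_lt_card
  have hττ : τ * τ = 1 := by
    have h := pow_card_eq_one (G := F ≃ₐ[F₀] F) (x := τ)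
    rwa [hcard, pow_two] at h
  have hτ'2 : τ' * τ' = 1 := by rw [hτ'τ, ← mul_inv_rev, hττ, inv_one]
  have hτ'1 : τ' ≠ 1 := by rw [hτ'τ]; exact fun h => hτ (inv_eq_one.mp h)
  -- the involution on real embeddings
  let ι : (F →+* ℝ) → (F →+* ℝ) := fun φ => φ.comp (τ' : F →+* F)
  have hιι : ∀ φ, ι (ι φ) = φ := fun φ => by
    refine RingHom.ext fun x => ?_
    change φ (τ' (τ' x)) = φ x
    rw [← AlgEquiv.mul_apply, hτ'2, AlgEquiv.one_apply]
  have hιfix : ∀ φ, ι φ ≠ φ := fun φ h => hτ'1 (by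
    refine AlgEquiv.ext fun x => φ.injective ?_
    exact congrArg (fun f : F →+* ℝ => f x) h)
  -- `D(φ) = θ(res c_φ)` for a chosen complex conjugation `c_φ`
  choose cc hcc using fun φ : F →+* ℝ => exists_isComplexConjugation φ
  let D : (F →+* ℝ) → ℂ := fun φ => ((θ (absGaloisRestrict F₀ F (cc φ)) : ℂˣ) : ℂ)
  have hD : ∀ φ, D φ = 1 ∨ D φ = -1 := fun φ => by
    have h := apply_absGaloisRestrict_sq_of_isComplexConjugation θ (hcc φ)
    have h' : D φ * D φ = 1 := by
      change ((θ _ : ℂˣ) : ℂ) * ((θ _ : ℂˣ) : ℂ) = 1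
      rw [← Units.val_mul, h, Units.val_one]
    have h'' : (D φ - 1) * (D φ + 1) = 0 := by linear_combination h'
    rcases mul_eq_zero.mp h'' with h1 | h1
    · exact Or.inl (by linear_combination h1)
    · exact Or.inr (by linear_combination h1)
  have hDι : ∀ φ, D (ι φ) = D φ := fun φ => by
    -- `θ_t (c_φ)` is a complex conjugation at `ι φ`
    have h1 : IsComplexConjugation (ι φ) (absGaloisOuterConj F₀ F t (cc φ)) :=
      isComplexConjugation_absGaloisOuterConj t (hcc φ)
    change ((θ (absGaloisRestrict F₀ F (cc (ι φ))) : ℂˣ) : ℂ) = (θ (absGaloisRestrict F₀ F (cc φ)) : ℂ)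
    rw [apply_absGaloisRestrict_eq_of_isComplexConjugation θ (hcc (ι φ)) h1,
      absGaloisRestrict_absGaloisOuterConj, map_mul, map_mul, map_inv, mul_inv_cancel_comm]
  -- solve the sign equations and realise the signs by an integer `a ≡ 1 (mod 4ℓ)`
  obtain ⟨s, hs, hsol⟩ := exists_sign_solution ι hιι hιfix D hD hDι
  have h𝔪 : (Ideal.span {(4 * (ℓ : ℕ) : 𝓞 F)} : Ideal (𝓞 F)) ≠ ⊥ := by
    rw [Ne, Ideal.span_singleton_eq_bot]
    refine mul_ne_zero (by norm_num) ?_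
    exact_mod_cast (Fact.out : ℓ.Prime).ne_zero
  obtain ⟨a, ha0, ha1, hsign⟩ := exists_sub_one_mem_sign_eq_embedding h𝔪 s hs
  obtain ⟨θS, hopen, hsq, hccval, hunr⟩ := exists_kummerCharacter a ha0
  have h4 : (4 : 𝓞 F) ∣ a - 1 := by
    obtain ⟨r, hr⟩ := Ideal.mem_span_singleton'.mp ha1
    exact ⟨r * ℓ, by rw [← hr]; ring⟩
  refine ⟨θS, hopen, hsq, fun w hℓw 𝔓 h𝔓 σ hσ => hunr h4 w ?_ 𝔓 h𝔓 σ hσ, fun φ c hc => ?_⟩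
  · -- `a ∉ w` for `w ∣ ℓ`: otherwise `1 = a - (a - 1) ∈ w`
    intro haw
    have h1 : a - 1 ∈ w.asIdeal := by
      obtain ⟨r, hr⟩ := Ideal.mem_span_singleton'.mp ha1
      rw [← hr, show r * (4 * ((ℓ : ℕ) : 𝓞 F)) = (r * 4) * ((ℓ : ℕ) : 𝓞 F) by ring]
      exact w.asIdeal.mul_mem_left _ hℓw
    have : (1 : 𝓞 F) ∈ w.asIdeal := by
      have := w.asIdeal.sub_mem haw h1
      rwa [sub_sub_cancel] at this
    exact w.isPrime.ne_top ((Ideal.eq_top_iff_one _).mpr this)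
  · -- the sign identity at a complex conjugation `c` at `φ`
    have h1 : IsComplexConjugation (ι φ) (absGaloisOuterConj F₀ F t c) :=
      isComplexConjugation_absGaloisOuterConj t hc
    apply Units.ext
    rw [Units.val_mul, Units.val_mul, hccval φ c hc, hccval (ι φ) _ h1, hsign, hsign,
      apply_absGaloisRestrict_eq_of_isComplexConjugation θ hc (hcc φ)]
    exact (hsol φ).trans (by norm_num)

end SignChar

end Summit.Langlands.Langlands.Theorems.TwistNormalization
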